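import Summits.HodgeConjecture.HodgeConjecture.Theses.LinearSystemTorelli
import Literature.AlgebraicGeometry.HodgeTheory.GysinHodgeClassLiftProofs
import Literature.AlgebraicGeometry.HodgeTheory.ComplexGysinRational
import Literature.AlgebraicGeometry.HodgeTheory.HodgeStructureOfHodgeModel
import Literature.AlgebraicGeometry.HodgeTheory.SupportedClassesRationalProofs
import Literature.AlgebraicGeometry.Motives.HodgeStructureSubstructures
import Literature.AlgebraicTopology.SingularHomology.PoincareDualityCorollaries
import Literature.AlgebraicTopology.SingularHomology.IntegralLattice

/-!
# Crux `TranscendentalOrSupported` (stmt-HodgeConjecture-10853), line `Sketch` — stub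
# `stub_perpRatSpanned`: the right-orthogonal of finitely many rational classes is rationally spanned

For `X` smooth projective of dimension `2p`, an orientation family `μ` and RATIONAL classes
`b j ∈ H²ᵖ(X(ℂ); ℂ)` (`j < r`), the right-orthogonal
`W⊥ = ⨅ⱼ ker ⟨b j ⌣ –, [X(ℂ)]_μ⟩ ⊆ H²ᵖ(X(ℂ); ℂ)` for the cup product pairing `cupPairing (μ hX)`
is SPANNED BY ITS RATIONAL CLASSES (`IsRationalClass`).

PROOF (a rational linear system has its complex solution space spanned by rational solutions).
`H²ᵖ(X(ℂ); ℂ) = ℂ ⊗_ℚ H²ᵖ(X(ℂ); ℚ)` through `β = ofRatClassBaseChange` (onto for smooth projective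
`X`, `ofRatClassBaseChange_surjective`), and `b j = β(1 ⊗ a j)` for rational `a j`. For a
`ℚ`-orientation `ν` of `X(ℂ)` (`Motives.ComplexPoints.isOrientableOver`) the complexified rational
fundamental class is `c • [X(ℂ)]_μ` with `c ≠ 0` (`exists_coeffChange_fundamentalClass_eq_smul`);
since cup product and Kronecker pairing commute with the change of coefficients `ℚ → ℂ`
(`singularCohomology.ringChange_cupProduct`, `kroneckerPairing_ringChange_coeffChange_rat` below),
`⟨b j ⌣ β(t), [X(ℂ)]_μ⟩ = c⁻¹ • (F ⊗ ℂ)(t)ⱼ` for the `ℚ`-linear `F = (⟨a j ⌣ –, [X(ℂ)]_ν⟩)ⱼ :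
H²ᵖ(X(ℂ); ℚ) → ℚʳ` (`cupPairing_ofRatClassBaseChange_eq`). Hence `W⊥ = β((ker F) ⊗ ℂ)` by
flatness of `ℂ/ℚ` (`HodgeStructure.mem_baseChange_ker_iff`), and `(ker F) ⊗ ℂ` is the `ℂ`-span of
the `1 ⊗ y`, `y ∈ ker F` (`Submodule.baseChange_eq_span`), whose images `β(1 ⊗ y) = y ⊗ 1` are
rational classes lying in `W⊥`.
-/

noncomputable section

-- `Summit.HodgeConjecture.HodgeConjecture.Theorems` is the mandated namespace (single-problem summit:
-- Problem = Summit), flagged by `linter.dupNamespace`; restated for stand-alone elaboration.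
set_option linter.dupNamespace false

open scoped TensorProduct
open Literature.AlgebraicGeometry.Motives Literature.AlgebraicGeometry.HodgeTheory
open Literature.AlgebraicTopology.SingularHomology

namespace Summit.HodgeConjecture.HodgeConjecture.Theorems

/-! ### The Kronecker pairing commutes with the change of coefficients `ℚ → ℂ` -/

section CoeffChange

open singularChainComplex singularCochainComplex

/-- **`⟨β ⊗ 1, z ⊗ 1⟩ = ⟨β, z⟩`** for the change of coefficients `ℚ → ℂ` on cohomology
(`singularCohomology.ringChange`) and homology (`singularHomology.coeffChange`) classes: on
representatives both sides are `∑ rᵢ β(σᵢ)` read in `ℂ` (`evalChain_baseChange`; Hatcher (2002),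
§3.1 p. 198, the rational analogue of the tree's integral `kroneckerPairing_ringChange_coeffChange`).
[cite: HatcherAT2002, §3.1 p. 198] -/
theorem kroneckerPairing_ringChange_coeffChange_rat {M : Type} [TopologicalSpace M] {k : ℕ}
    (β : singularCohomology ℚ ℚ M k) (z : singularHomology ℚ ℚ M k) :
    kroneckerPairing ℂ ℂ M k (singularCohomology.ringChange (algebraMap ℚ ℂ) M k β)
        (singularHomology.coeffChange M (algebraMap ℚ ℂ : ℚ →+* ℂ).toAddMonoidHom k z) =
      algebraMap ℚ ℂ (kroneckerPairing ℚ ℚ M k β z) := by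
  induction β using singularCohomology_induction_on with
  | h a =>
    induction z using singularHomology_induction_on with
    | h zc =>
      rw [singularHomology.coeffChange_homologyπ, singularCohomology.ringChange_π,
        kroneckerPairing_π_homologyπ_eq_evalChain, iCycles_cyclesCoeffChange,
        kroneckerPairing_π_homologyπ_eq_evalChain]
      change evalChain (coFn (cocyclesRingChange (algebraMap ℚ ℂ) k a))
          (baseChangeChain ℚ ℂ k (iCycles ℚ ℚ M k zc)) = _
      rw [coFn_cocyclesRingChange]
      exact evalChain_baseChange ℚ ℂ (coFn a) (iCycles ℚ ℚ M k zc)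

end CoeffChange

/-! ### Cup product pairings of rational classes -/

variable {n : ℕ} {X : SchemeOver ℂ}

/-- **The complex cup pairing on rational classes is the rational cup pairing up to the
orientation scalar.** For `X` smooth projective of dimension `n`, an orientation family `μ`, a
`ℚ`-orientation `ν` of `X(ℂ)` whose complexified fundamental class is `c • [X(ℂ)]_μ`, and rational
classes `a ∈ Hᵏ(X(ℂ); ℚ)`, `y ∈ Hˡ(X(ℂ); ℚ)` (`k + l = 2n`):
`c • ⟨(a ⊗ 1) ⌣ (y ⊗ 1), [X(ℂ)]_μ⟩ = ⟨a ⌣ y, [X(ℂ)]_ν⟩` (the cup product is natural in the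
coefficient ring, `singularCohomology.ringChange_cupProduct`, and
`kroneckerPairing_ringChange_coeffChange_rat`). [cite: HatcherAT2002, §3.1 p. 198 and §3.2 p. 215] -/
theorem smul_cupPairing_ofRatClass_ofRatClass (μ : OrientationFamily) (hX : IsSmoothProjective n X)
    (ν : HomologicalOrientation ℚ (ComplexPoints X) (2 * n)) {c : ℂ}
    (hc : singularHomology.coeffChange (ComplexPoints X) (algebraMap ℚ ℂ).toAddMonoidHom (2 * n)
      ν.fundamentalClass = c • (μ hX).fundamentalClass)
    {k l : ℕ} (h : k + l = 2 * n) (a : singularCohomology ℚ ℚ (ComplexPoints X) k)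
    (y : singularCohomology ℚ ℚ (ComplexPoints X) l) :
    c * cupPairing (μ hX) h (ofRatClass (ComplexPoints X) k a) (ofRatClass (ComplexPoints X) l y) =
      algebraMap ℚ ℂ (cupPairing ν h a y) := by
  rw [cupPairing_apply, cupPairing_apply, ofRatClass_eq_ringChange, ofRatClass_eq_ringChange,
    ← singularCohomology.ringChange_cupProduct, ← kroneckerPairing_ringChange_coeffChange_rat, hc,
    map_smul, smul_eq_mul]

/-- Pointwise form with the scalar inverted: for `c ≠ 0`,
`⟨(a ⊗ 1) ⌣ (y ⊗ 1), [X(ℂ)]_μ⟩ = c⁻¹ • ⟨a ⌣ y, [X(ℂ)]_ν⟩`. [cite: HatcherAT2002, §3.1 p. 198] -/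
theorem cupPairing_ofRatClass_ofRatClass (μ : OrientationFamily) (hX : IsSmoothProjective n X)
    (ν : HomologicalOrientation ℚ (ComplexPoints X) (2 * n)) {c : ℂ} (hc0 : c ≠ 0)
    (hc : singularHomology.coeffChange (ComplexPoints X) (algebraMap ℚ ℂ).toAddMonoidHom (2 * n)
      ν.fundamentalClass = c • (μ hX).fundamentalClass)
    {k l : ℕ} (h : k + l = 2 * n) (a : singularCohomology ℚ ℚ (ComplexPoints X) k)
    (y : singularCohomology ℚ ℚ (ComplexPoints X) l) :
    cupPairing (μ hX) h (ofRatClass (ComplexPoints X) k a) (ofRatClass (ComplexPoints X) l y) =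
      c⁻¹ * algebraMap ℚ ℂ (cupPairing ν h a y) := by
  rw [← smul_cupPairing_ofRatClass_ofRatClass μ hX ν hc h a y, ← mul_assoc, inv_mul_cancel₀ hc0,
    one_mul]

/-- **The complex cup pairing against rational classes, through the complexification.** With the
data of `cupPairing_ofRatClass_ofRatClass` and finitely many rational classes `a j ∈ Hᵏ(X(ℂ); ℚ)`,
for every `t ∈ ℂ ⊗_ℚ Hˡ(X(ℂ); ℚ)`:
`⟨(a j ⊗ 1) ⌣ β(t), [X(ℂ)]_μ⟩ = c⁻¹ • ((F ⊗ ℂ) t)ⱼ`, where `β = ofRatClassBaseChange` and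
`F = (⟨a j ⌣ –, [X(ℂ)]_ν⟩)ⱼ : Hˡ(X(ℂ); ℚ) → ℚʳ`, the identification `ℂ ⊗_ℚ ℚʳ = ℂʳ` being
`TensorProduct.piScalarRight` (check on pure tensors). [cite: HatcherAT2002, §3.1 p. 198] -/
theorem cupPairing_ofRatClassBaseChange_eq (μ : OrientationFamily) (hX : IsSmoothProjective n X)
    (ν : HomologicalOrientation ℚ (ComplexPoints X) (2 * n)) {c : ℂ} (hc0 : c ≠ 0)
    (hc : singularHomology.coeffChange (ComplexPoints X) (algebraMap ℚ ℂ).toAddMonoidHom (2 * n)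
      ν.fundamentalClass = c • (μ hX).fundamentalClass)
    {k l : ℕ} (h : k + l = 2 * n) {r : ℕ} (a : Fin r → singularCohomology ℚ ℚ (ComplexPoints X) k)
    (t : ℂ ⊗[ℚ] singularCohomology ℚ ℚ (ComplexPoints X) l) (j : Fin r) :
    cupPairing (μ hX) h (ofRatClass (ComplexPoints X) k (a j))
        (ofRatClassBaseChange (ComplexPoints X) l t) =
      c⁻¹ * TensorProduct.piScalarRight ℚ ℂ ℂ (Fin r)
        ((LinearMap.pi fun i ↦ cupPairing ν h (a i)).baseChange ℂ t) j := by
  induction t using TensorProduct.induction_on with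
  | zero => simp only [map_zero, Pi.zero_apply, mul_zero]
  | tmul z y =>
    rw [ofRatClassBaseChange_tmul, map_smul, cupPairing_ofRatClass_ofRatClass μ hX ν hc0 hc h,
      LinearMap.baseChange_tmul, TensorProduct.piScalarRight_apply,
      TensorProduct.piScalarRightHom_tmul]
    simp only [LinearMap.pi_apply, smul_eq_mul]
    rw [Algebra.smul_def]
    ring
  | add s t hs ht =>
    rw [map_add, map_add, hs, ht, map_add, map_add, Pi.add_apply, mul_add]

/-! ### The stub -/

/-- **`W⊥` is spanned by its rational classes** (stub `stub_perpRatSpanned` of the line `Sketch` of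
the crux `TranscendentalOrSupported`): for `X` smooth projective of dimension `2p`, an orientation
family `μ` and rational classes `b j ∈ H²ᵖ(X(ℂ); ℂ)`, the right-orthogonal
`W⊥ = ⨅ⱼ ker ⟨b j ⌣ –, [X(ℂ)]_μ⟩` equals the `ℂ`-span of its rational classes. Write
`b j = a j ⊗ 1`; through `β : ℂ ⊗_ℚ H²ᵖ(X(ℂ); ℚ) ≅ H²ᵖ(X(ℂ); ℂ)` (`ofRatClassBaseChange_surjective`)
the functionals `⟨b j ⌣ –, [X(ℂ)]_μ⟩ ∘ β` are `c⁻¹ •` the complexification of the rational linear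
system `F = (⟨a j ⌣ –, [X(ℂ)]_ν⟩)ⱼ` for a `ℚ`-orientation `ν`
(`cupPairing_ofRatClassBaseChange_eq`, `exists_coeffChange_fundamentalClass_eq_smul`), so
`W⊥ = β((ker F) ⊗ ℂ)` (`HodgeStructure.mem_baseChange_ker_iff`, flatness of `ℂ/ℚ`), which is
spanned by the rational classes `y ⊗ 1`, `y ∈ ker F` (`Submodule.baseChange_eq_span`).
[cite: VoisinHodgeI2002, §7.1.1] [cite: HatcherAT2002, §3.1 p. 198] -/
theorem stub_perpRatSpanned :
    ∀ (μ : OrientationFamily) ⦃p : ℕ⦄ ⦃X : SchemeOver ℂ⦄ (hX : IsSmoothProjective (2 * p) X) (r : ℕ)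
    (b : Fin r → complexBetti X (2 * p)), (∀ j, IsRationalClass (b j)) →
    Submodule.span ℂ {x : complexBetti X (2 * p) |
        x ∈ (⨅ j, LinearMap.ker (cupPairing (μ hX) (two_mul (2 * p)).symm (b j))) ∧ IsRationalClass x} =
      ⨅ j, LinearMap.ker (cupPairing (μ hX) (two_mul (2 * p)).symm (b j)) := by
  intro μ p X hX r b hb
  refine le_antisymm (Submodule.span_le.2 fun x hx ↦ hx.1) fun x hx ↦ ?_
  -- the rational classes `a j` with `b j = a j ⊗ 1`
  have hab : ∀ j, ∃ a : singularCohomology ℚ ℚ (ComplexPoints X) (2 * p),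
      ofRatClass (ComplexPoints X) (2 * p) a = b j :=
    fun j ↦ (isRationalClass_iff_mem_range_ofRatClass (b j)).1 (hb j)
  choose a ha using hab
  -- a `ℚ`-orientation and the orientation scalar
  obtain ⟨ν⟩ := ComplexPoints.isOrientableOver ℚ hX
  obtain ⟨c, hc0, hc⟩ := exists_coeffChange_fundamentalClass_eq_smul μ hX ν
  -- the rational linear system
  set F : singularCohomology ℚ ℚ (ComplexPoints X) (2 * p) →ₗ[ℚ] (Fin r → ℚ) :=
    LinearMap.pi fun i ↦ cupPairing ν (two_mul (2 * p)).symm (a i) with hF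
  -- `x = β t` with `(F ⊗ ℂ) t = 0`
  obtain ⟨t, rfl⟩ := ofRatClassBaseChange_surjective hX (2 * p) x
  have hFt : F.baseChange ℂ t = 0 := by
    apply (TensorProduct.piScalarRight ℚ ℂ ℂ (Fin r)).injective
    rw [map_zero]
    funext j
    have hj : cupPairing (μ hX) (two_mul (2 * p)).symm (b j)
        (ofRatClassBaseChange (ComplexPoints X) (2 * p) t) = 0 :=
      LinearMap.mem_ker.1 ((Submodule.mem_iInf _).1 hx j)
    rw [← ha j, cupPairing_ofRatClassBaseChange_eq μ hX ν hc0 hc _ a t j] at hj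
    exact (mul_eq_zero.1 hj).resolve_left (inv_ne_zero hc0)
  -- hence `t ∈ (ker F) ⊗ ℂ = span {1 ⊗ y | y ∈ ker F}`
  have ht : t ∈ (LinearMap.ker F).baseChange ℂ := (HodgeStructure.mem_baseChange_ker_iff F t).2 hFt
  rw [Submodule.baseChange_eq_span] at ht
  -- and the `β (1 ⊗ y) = y ⊗ 1`, `y ∈ ker F`, are rational classes in `W⊥`
  have hle : Submodule.span ℂ ((LinearMap.ker F).map
      (TensorProduct.mk ℚ ℂ (singularCohomology ℚ ℚ (ComplexPoints X) (2 * p)) 1) : Set _) ≤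
      (Submodule.span ℂ {x : complexBetti X (2 * p) |
        x ∈ (⨅ j, LinearMap.ker (cupPairing (μ hX) (two_mul (2 * p)).symm (b j))) ∧
          IsRationalClass x}).comap (ofRatClassBaseChange (ComplexPoints X) (2 * p)) := by
    rw [Submodule.span_le]
    rintro _ ⟨y, hy, rfl⟩
    rw [SetLike.mem_coe, Submodule.mem_comap, TensorProduct.mk_apply, ofRatClassBaseChange_tmul,
      one_smul]
    refine Submodule.subset_span ⟨(Submodule.mem_iInf _).2 fun j ↦ ?_, isRationalClass_ofRatClass y⟩
    have hy0 : cupPairing ν (two_mul (2 * p)).symm (a j) y = 0 := by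
      have h0 : F y = 0 := LinearMap.mem_ker.1 hy
      simpa only [hF, LinearMap.pi_apply, Pi.zero_apply] using congrFun h0 j
    rw [LinearMap.mem_ker, ← ha j, cupPairing_ofRatClass_ofRatClass μ hX ν hc0 hc _ (a j) y, hy0,
      map_zero, mul_zero]
  exact hle ht

end Summit.HodgeConjecture.HodgeConjecture.Theorems

end
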